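import Summits.QuantumFields.YangMills.Theorems.UnitScaleTiltProp7FibreTrueLinDefectMass
import Summits.QuantumFields.YangMills.Theorems.UnitScaleTiltProp7TrueLinIterStructure
import HarnessLib

/-!
# Route `UnitScaleTilt`, crux K1 «MinimiserStabilityRegPr» (stmt-QuantumFields-19200), route-R [RP] curved, the fibre core's residual (B7) —
# THE `ℓ²` MASSES OF THE NONLINEAR LEVEL RATIOS `Y_i = pertVar Ū₀^{(i)}W̄^{(i)}` AT EVERY LEVEL `i`: true-lin structure `Y_i = Q i Y + D_i`,
# `‖D_i‖_{ℓ²} ≤ E_i·S_i + 2√d·Σ_{j<i}C_CM·E_j·S_j` (sup × mass sources), `‖Q i Y‖_{ℓ²} ≤ ρⁱ·E_i·‖Y‖_{ℓ²} + 2√d·‖Λ_i‖_{ℓ²}`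

Cell `ym3-torus`, D-0154 (3c) twin-width seat `ym-routeR-w3` (gen 2); successor file of ✓ `…FibreTrueLinDefect` (B) ∕ ✓ `…FibreTrueLinDefectMass` (C) of the same seat.
THEOREMS ONLY (0 `def`, 0 `sorry`); `--supports stmt-QuantumFields-19200`, count-neutral.  YM₃ on T³ is a ladder rung (R3), not the Clay problem; nothing here claims the
stub, the crux, d = 4 or the mass gap.

THE POINT.  The fibre core ✓ `Prop7CurvedLandauCoreFinalT3.sum_normSq_le_curl_sq_core_of_fibre_T3'` displays, inside its explicit `Z_Q` term, the `ℓ²` MASSES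
`‖Y_i‖_{ℓ²} = √Σ_b‖pertVar Ū₀^{(i)}W̄^{(i)} b‖²` of the nonlinear level ratios for `i < K − n` (census 09:18Z, residual (B7)).  A free-standing «Jensen» bound
`‖Y_i‖² ≤ C·L^{(2−d)i}‖Y‖²` is FALSE for a generic `Y` (the (0.4) stair-averaging maps a pure-gauge bump at a centre to itself), so the supplier must see the structure:
files B∕C already run the sourced split `D_j := Y_j − Q j Y`, `D_0 = 0`, `D_{j+1} = T_jD_j + R_j` and bound `‖D_k‖_{ℓ²}` (✓ A2 `sqrt_sum_normSq_sourced_le`) — at level `k`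
they then use the fibre identity `Y_k = 0`; at a level `i < k` the SAME bound reads `‖Y_i − Q i Y‖_{ℓ²} ≤ E_i·S_i + 2√d·Σ_{j<i}C_CM·E_j·S_j` (§1, no fibre hypothesis), and the
true linearised iterate of the generic `Y` is controlled by ★w2-20520 g3's structure theorem ✓ `Prop7TrueLinIterStructure.trueLinIter_structure` (`Q i Y = G_i + P_{Ū₀^{(i)}}Λ_i`),
the reduced row ✓ `Prop7TrueLinIterDefect.sqrt_sum_normSq_reduced_sub_lineIter_le` (conjunct 2: `‖G_i‖_{ℓ²} ≤ ρⁱE_i‖Y‖_{ℓ²}`, `ρ = √((L^d)⁻¹L²)`) and the coarse gauge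
function `Λ_i` (§2) — whose `(H¹)^*` bound at every level is ★routeR-w2's ✓ `Prop7CovIterLambdaHLambda.sum_normSq_covIterLambda_le_T3` (consumed in the T³ sequel, not here).
§3 adds the two (Minkowski): `‖Y_i‖_{ℓ²} ≤ ρⁱE_i‖Y‖_{ℓ²} + 2√d‖Λ_i‖_{ℓ²} + E_i·S_i + 2√d·Σ_{j<i}C_CM·E_j·S_j`, `S_j = Σ_{l<j}ρ^{j−1−l}·260·μ_l·((d+2)L√((2dL^d)(2d))·‖Y_l‖_{ℓ²})`
— a TRIANGULAR system in the masses (the `S_j` only see levels `l < j ≤ i`), closed by induction in the T³ sequel.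

WHAT IS PROVED (ns `…Theorems.Prop7FibreLevelMass`; `SU(N)`, any `P`, `k ≤ m + K`; letters of B∕C VERBATIM).
* §1 ★ `sqrt_sum_normSq_levelRatio_sub_trueLinIter_le` (walk masses `m j c` displayed, as B), ★ `sqrt_sum_normSq_levelRatio_sub_trueLinIter_le_mass` (two-block sup × mass
  reading `μ_j`, as C).
* §2 ★ `sqrt_sum_normSq_trueLinIter_le_of_structure` — `√Σ_c‖Q k Y c‖² ≤ ρᵏE_k√Σ‖Y‖² + 2√d·√Σ_y‖Λ k y‖²` for the recursion families `G, S, Λ` of record (displayed, zero content).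
* §3 ★★ `sqrt_sum_normSq_levelRatio_le` — the level-`k` mass of the nonlinear ratio field, sum of §1-mass and §2.
HONEST SCOPE.  Minkowski bookkeeping over landed bricks; nothing of [Balaban1985Averaging] ∕ [Balaban1984PropagatorsI] is asserted beyond the cited tree theorems; the
per-level sups `μ_j` ((B6), local η-flat gauges) and the coarse gauge function `Λ_i` ((R-B) at level `i`) stay displayed here.

References: T. Bałaban, CMP 98 (1985) 17–51 [Balaban1985Averaging] (Prop. 3 (122)–(126) p.36); CMP 95 (1984) 17–40 [Balaban1984PropagatorsI] ((1.18)–(1.20) pp.19–20);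
CMP 102 (1985) 277–309 [Balaban1985Variational] ((15) p.280, Prop. 7 p.299); CMP 109 (1987) 249–301 [Balaban1987RG1] ((0.3)–(0.4) pp.252–253).
-/

set_option autoImplicit false

noncomputable section

open scoped BigOperators Matrix.Norms.L2Operator

namespace Summit.QuantumFields.YangMills.Theorems.Prop7FibreLevelMass

open Literature.MathematicalPhysics.QuantumFieldTheory.Balaban1983to89
open Finset T4Continuum BlockAveraging AveragingRT ExpMeanLog BlockAveragingEMLLinearised BlockAveragingEMLLinearisedBackground BlockAveragingEMLProp2
open Summit.QuantumFields.YangMills.Theorems.Prop7TrueLinSourcedStructure (exists_sourced_reduced_family sub_sourced)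
open Summit.QuantumFields.YangMills.Theorems.Prop7TrueLinSourcedDefect (sqrt_sum_normSq_sourced_le)
open Summit.QuantumFields.YangMills.Theorems.Prop7CurvedLandauRowA (exists_coarseGauge_family)
open Summit.QuantumFields.YangMills.Theorems.Prop7FibreTrueLinDefect (sqrt_sum_normSq_oneStep_remainder_le)
open Summit.QuantumFields.YangMills.Theorems.Prop7FibreTrueLinDefectMass (sqrt_sum_nbhdMass_pow_four_le)
open Summit.QuantumFields.YangMills.Theorems.Prop7TrueLinDefectBound (mass_loop_le mass_segment_le)
open Summit.QuantumFields.YangMills.Theorems.Prop7TrueLinIterDefect (sqrt_sum_norm_add_sq_le sqrt_sum_normSq_reduced_sub_lineIter_le)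
open Summit.QuantumFields.YangMills.Theorems.Prop7TrueLinIterStructure (trueLinIter_structure norm_pureGauge_le)
open Summit.QuantumFields.YangMills.Theorems.Prop7CovIterLambdaBound (sqrt_sum_sq_add_le)
open Summit.QuantumFields.YangMills.Theorems.Prop7PinnedFlatCoercivity (sum_pbond_tgt_add_src)

variable {P : Params} {N : ℕ} [NeZero N]

/-! ## §1 ★ The nonlinear level ratio minus the true linearised iterate, at every level -/

/-- ★ **THE LEVEL RATIOS AGAINST THE TRUE LINEARISED ITERATE, IN `ℓ²`, AT EVERY LEVEL** (file B's ★★★ theorem WITHOUT the fibre hypothesis).  `U₀, W ∈ SU(N)` on the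
finest torus, `k ≤ m + K`; `Q` the true linearised iterate of ✓ p606268 (`hQ0`, `hQs`); tower sizes: loop variables `dist1(W^{(j)}_i(c)) ≤ a j ≤ 1/24`, `a j < δ_N`, plaquettes
`dist1(Ū₀^{(j)}(∂q)) ≤ a′`; DISPLAYED per-level walk masses `m j c` of the level ratios `Y_j = pertVar Ū₀^{(j)} W̄^{(j)}` along the (0.4) walks at `c` with `72·m ≤ 1`,
`3m + a_j < δ_N`.  Then, with `ρ = √((L^d)⁻¹L²)`, `κ = 159·(d+2)L·√((2dL^d)(2d))`, `C_CM = √(4d(d+2)²NL⁴ + 4(d+2)²d³(3N+2d)L⁶a′²)`, `E_j = exp((κ/ρ)Σ_{i<j}a i)`,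
`S_j = Σ_{i<j}ρ^{j−1−i}·260·√(Σ_c m_i(c)⁴)`:  `√(Σ_c‖Y_k(c) − Q k (pertVar U₀ W) c‖²) ≤ E_k·S_k + 2√d·Σ_{j<k}C_CM·(E_j·S_j)`.
[cite: Balaban1985Averaging, Prop. 3 (122)-(126) p.36; Balaban1984PropagatorsI, (1.18)-(1.20) pp.19-20; Balaban1985Variational, Prop. 7 p.299] -/
theorem sqrt_sum_normSq_levelRatio_sub_trueLinIter_le (U₀ W : GaugeField P 0 (Matrix.specialUnitaryGroup (Fin N) ℂ)) {k : ℕ} (hk : k ≤ P.m + P.K)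
    (Q : (k : ℕ) → (PBond P 0 → Matrix (Fin N) (Fin N) ℂ) → PBond P k → Matrix (Fin N) (Fin N) ℂ) (hQ0 : ∀ Y, Q 0 Y = Y)
    (hQs : ∀ (k : ℕ) (Y : PBond P 0 → Matrix (Fin N) (Fin N) ℂ) (c : PBond P (k + 1)), Q (k + 1) Y c
      = (fderiv ℂ (eml : (Idx P → Matrix (Fin N) (Fin N) ℂ) → Matrix (Fin N) (Fin N) ℂ)
            (fun i => ((loopHol (Averaging.iter (fun i => blockAvg (P := P) (j := i) (expMeanLogSU (n := Fin N))) k U₀) c i : Matrix.specialUnitaryGroup (Fin N) ℂ) : Matrix (Fin N) (Fin N) ℂ))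
            (fun i => covWalkSum (Averaging.iter (fun i => blockAvg (P := P) (j := i) (expMeanLogSU (n := Fin N))) k U₀) (Q k Y) (walk (emb c.src) (loopWord P.L c.dir (off i.1) i.2.1 i.2.2))
              * ((loopHol (Averaging.iter (fun i => blockAvg (P := P) (j := i) (expMeanLogSU (n := Fin N))) k U₀) c i : Matrix.specialUnitaryGroup (Fin N) ℂ) : Matrix (Fin N) (Fin N) ℂ))
            * star ((corr (expMeanLogSU (n := Fin N)) (Averaging.iter (fun i => blockAvg (P := P) (j := i) (expMeanLogSU (n := Fin N))) k U₀) c : Matrix.specialUnitaryGroup (Fin N) ℂ) : Matrix (Fin N) (Fin N) ℂ)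
          + ((corr (expMeanLogSU (n := Fin N)) (Averaging.iter (fun i => blockAvg (P := P) (j := i) (expMeanLogSU (n := Fin N))) k U₀) c : Matrix.specialUnitaryGroup (Fin N) ℂ) : Matrix (Fin N) (Fin N) ℂ)
            * covWalkSum (Averaging.iter (fun i => blockAvg (P := P) (j := i) (expMeanLogSU (n := Fin N))) k U₀) (Q k Y) (walk (emb c.src) (List.replicate P.L (c.dir, true)))
            * star ((corr (expMeanLogSU (n := Fin N)) (Averaging.iter (fun i => blockAvg (P := P) (j := i) (expMeanLogSU (n := Fin N))) k U₀) c : Matrix.specialUnitaryGroup (Fin N) ℂ) : Matrix (Fin N) (Fin N) ℂ)))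
    (a : ℕ → ℝ) (ha0 : ∀ j, 0 ≤ a j) {a' : ℝ} (ha' : 0 ≤ a')
    (hα : ∀ j < k, ∀ (c : PBond P (j + 1)) (i : Idx P), dist1 (loopHol (Averaging.iter (fun i => blockAvg (P := P) (j := i) (expMeanLogSU (n := Fin N))) j U₀) c i) ≤ a j)
    (ha24 : ∀ j < k, a j ≤ 1 / 24) (haN : ∀ j < k, a j < deltaSU (Fin N))
    (hV : ∀ j < k, ∀ q : Plaq P j, dist1 (GaugeField.plaqHol (Averaging.iter (fun i => blockAvg (P := P) (j := i) (expMeanLogSU (n := Fin N))) j U₀) q) ≤ a')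
    (m : (j : ℕ) → PBond P (j + 1) → ℝ)
    (hmL : ∀ j < k, ∀ (c : PBond P (j + 1)) (i : Idx P),
      ((walk (emb c.src) (loopWord P.L c.dir (off i.1) i.2.1 i.2.2)).map fun s => ‖pertVar (Averaging.iter (fun i => blockAvg (P := P) (j := i) (expMeanLogSU (n := Fin N))) j U₀) (Averaging.iter (fun i => blockAvg (P := P) (j := i) (expMeanLogSU (n := Fin N))) j W) s.bond‖).sum ≤ m j c)
    (hmS : ∀ j < k, ∀ c : PBond P (j + 1), ((walk (emb c.src) (List.replicate P.L (c.dir, true))).map fun s => ‖pertVar (Averaging.iter (fun i => blockAvg (P := P) (j := i) (expMeanLogSU (n := Fin N))) j U₀) (Averaging.iter (fun i => blockAvg (P := P) (j := i) (expMeanLogSU (n := Fin N))) j W) s.bond‖).sum ≤ m j c)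
    (hm72 : ∀ j < k, ∀ c : PBond P (j + 1), 72 * m j c ≤ 1) (hmN : ∀ j < k, ∀ c : PBond P (j + 1), 3 * m j c + a j < deltaSU (Fin N)) :
    Real.sqrt (∑ c : PBond P k, ‖(pertVar (Averaging.iter (fun i => blockAvg (P := P) (j := i) (expMeanLogSU (n := Fin N))) k U₀) (Averaging.iter (fun i => blockAvg (P := P) (j := i) (expMeanLogSU (n := Fin N))) k W)) c - Q k (pertVar U₀ W) c‖ ^ 2)
      ≤ Real.exp ((159 * (((P.d + 2) * P.L : ℕ) : ℝ) * Real.sqrt (2 * P.d * (P.L : ℝ) ^ P.d * (2 * P.d))) / Real.sqrt (((P.L : ℝ) ^ P.d)⁻¹ * (P.L : ℝ) ^ 2) * ∑ i ∈ Finset.range k, a i) * (∑ i ∈ Finset.range k, Real.sqrt (((P.L : ℝ) ^ P.d)⁻¹ * (P.L : ℝ) ^ 2) ^ (k - 1 - i) * (260 * Real.sqrt (∑ c : PBond P (i + 1), m i c ^ 4)))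
        + 2 * Real.sqrt P.d * ∑ j ∈ Finset.range k, Real.sqrt (4 * P.d * (((P.d : ℝ) + 2) ^ 2 * N * (P.L : ℝ) ^ 4) + (4 * ((P.d : ℝ) + 2) ^ 2 * (P.d : ℝ) ^ 3 * (3 * N + 2 * P.d) * (P.L : ℝ) ^ 6) * a' ^ 2) * (Real.exp ((159 * (((P.d + 2) * P.L : ℕ) : ℝ) * Real.sqrt (2 * P.d * (P.L : ℝ) ^ P.d * (2 * P.d))) / Real.sqrt (((P.L : ℝ) ^ P.d)⁻¹ * (P.L : ℝ) ^ 2) * ∑ i ∈ Finset.range j, a i) * (∑ i ∈ Finset.range j, Real.sqrt (((P.L : ℝ) ^ P.d)⁻¹ * (P.L : ℝ) ^ 2) ^ (j - 1 - i) * (260 * Real.sqrt (∑ c : PBond P (i + 1), m i c ^ 4)))) := by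
  -- the sourced family `D_j = Y_j − Q_j(Y_0)` and its drive (file B, verbatim)
  have hDs : ∀ (j : ℕ) (c : PBond P (j + 1)),
      (fun j => (pertVar (Averaging.iter (fun i => blockAvg (P := P) (j := i) (expMeanLogSU (n := Fin N))) j U₀) (Averaging.iter (fun i => blockAvg (P := P) (j := i) (expMeanLogSU (n := Fin N))) j W)) - Q j (pertVar U₀ W)) (j + 1) c
        = (fderiv ℂ (eml : (Idx P → Matrix (Fin N) (Fin N) ℂ) → Matrix (Fin N) (Fin N) ℂ)
            (fun i => ((loopHol (Averaging.iter (fun i => blockAvg (P := P) (j := i) (expMeanLogSU (n := Fin N))) j U₀) c i : Matrix.specialUnitaryGroup (Fin N) ℂ) : Matrix (Fin N) (Fin N) ℂ))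
            (fun i => covWalkSum (Averaging.iter (fun i => blockAvg (P := P) (j := i) (expMeanLogSU (n := Fin N))) j U₀) ((fun j => (pertVar (Averaging.iter (fun i => blockAvg (P := P) (j := i) (expMeanLogSU (n := Fin N))) j U₀) (Averaging.iter (fun i => blockAvg (P := P) (j := i) (expMeanLogSU (n := Fin N))) j W)) - Q j (pertVar U₀ W)) j) (walk (emb c.src) (loopWord P.L c.dir (off i.1) i.2.1 i.2.2))
              * ((loopHol (Averaging.iter (fun i => blockAvg (P := P) (j := i) (expMeanLogSU (n := Fin N))) j U₀) c i : Matrix.specialUnitaryGroup (Fin N) ℂ) : Matrix (Fin N) (Fin N) ℂ))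
            * star ((corr (expMeanLogSU (n := Fin N)) (Averaging.iter (fun i => blockAvg (P := P) (j := i) (expMeanLogSU (n := Fin N))) j U₀) c : Matrix.specialUnitaryGroup (Fin N) ℂ) : Matrix (Fin N) (Fin N) ℂ)
          + ((corr (expMeanLogSU (n := Fin N)) (Averaging.iter (fun i => blockAvg (P := P) (j := i) (expMeanLogSU (n := Fin N))) j U₀) c : Matrix.specialUnitaryGroup (Fin N) ℂ) : Matrix (Fin N) (Fin N) ℂ)
            * covWalkSum (Averaging.iter (fun i => blockAvg (P := P) (j := i) (expMeanLogSU (n := Fin N))) j U₀) ((fun j => (pertVar (Averaging.iter (fun i => blockAvg (P := P) (j := i) (expMeanLogSU (n := Fin N))) j U₀) (Averaging.iter (fun i => blockAvg (P := P) (j := i) (expMeanLogSU (n := Fin N))) j W)) - Q j (pertVar U₀ W)) j) (walk (emb c.src) (List.replicate P.L (c.dir, true)))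
            * star ((corr (expMeanLogSU (n := Fin N)) (Averaging.iter (fun i => blockAvg (P := P) (j := i) (expMeanLogSU (n := Fin N))) j U₀) c : Matrix.specialUnitaryGroup (Fin N) ℂ) : Matrix (Fin N) (Fin N) ℂ)) + ((pertVar (Averaging.iter (fun i => blockAvg (P := P) (j := i) (expMeanLogSU (n := Fin N))) (j + 1) U₀) (Averaging.iter (fun i => blockAvg (P := P) (j := i) (expMeanLogSU (n := Fin N))) (j + 1) W)) c - (fderiv ℂ (eml : (Idx P → Matrix (Fin N) (Fin N) ℂ) → Matrix (Fin N) (Fin N) ℂ)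
            (fun i => ((loopHol (Averaging.iter (fun i => blockAvg (P := P) (j := i) (expMeanLogSU (n := Fin N))) j U₀) c i : Matrix.specialUnitaryGroup (Fin N) ℂ) : Matrix (Fin N) (Fin N) ℂ))
            (fun i => covWalkSum (Averaging.iter (fun i => blockAvg (P := P) (j := i) (expMeanLogSU (n := Fin N))) j U₀) (pertVar (Averaging.iter (fun i => blockAvg (P := P) (j := i) (expMeanLogSU (n := Fin N))) j U₀) (Averaging.iter (fun i => blockAvg (P := P) (j := i) (expMeanLogSU (n := Fin N))) j W)) (walk (emb c.src) (loopWord P.L c.dir (off i.1) i.2.1 i.2.2))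
              * ((loopHol (Averaging.iter (fun i => blockAvg (P := P) (j := i) (expMeanLogSU (n := Fin N))) j U₀) c i : Matrix.specialUnitaryGroup (Fin N) ℂ) : Matrix (Fin N) (Fin N) ℂ))
            * star ((corr (expMeanLogSU (n := Fin N)) (Averaging.iter (fun i => blockAvg (P := P) (j := i) (expMeanLogSU (n := Fin N))) j U₀) c : Matrix.specialUnitaryGroup (Fin N) ℂ) : Matrix (Fin N) (Fin N) ℂ)
          + ((corr (expMeanLogSU (n := Fin N)) (Averaging.iter (fun i => blockAvg (P := P) (j := i) (expMeanLogSU (n := Fin N))) j U₀) c : Matrix.specialUnitaryGroup (Fin N) ℂ) : Matrix (Fin N) (Fin N) ℂ)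
            * covWalkSum (Averaging.iter (fun i => blockAvg (P := P) (j := i) (expMeanLogSU (n := Fin N))) j U₀) (pertVar (Averaging.iter (fun i => blockAvg (P := P) (j := i) (expMeanLogSU (n := Fin N))) j U₀) (Averaging.iter (fun i => blockAvg (P := P) (j := i) (expMeanLogSU (n := Fin N))) j W)) (walk (emb c.src) (List.replicate P.L (c.dir, true)))
            * star ((corr (expMeanLogSU (n := Fin N)) (Averaging.iter (fun i => blockAvg (P := P) (j := i) (expMeanLogSU (n := Fin N))) j U₀) c : Matrix.specialUnitaryGroup (Fin N) ℂ) : Matrix (Fin N) (Fin N) ℂ))) := by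
    intro j c
    exact sub_sourced U₀ (fun j => (pertVar (Averaging.iter (fun i => blockAvg (P := P) (j := i) (expMeanLogSU (n := Fin N))) j U₀) (Averaging.iter (fun i => blockAvg (P := P) (j := i) (expMeanLogSU (n := Fin N))) j W))) (fun j => Q j (pertVar U₀ W)) (fun j c => ((pertVar (Averaging.iter (fun i => blockAvg (P := P) (j := i) (expMeanLogSU (n := Fin N))) (j + 1) U₀) (Averaging.iter (fun i => blockAvg (P := P) (j := i) (expMeanLogSU (n := Fin N))) (j + 1) W)) c - (fderiv ℂ (eml : (Idx P → Matrix (Fin N) (Fin N) ℂ) → Matrix (Fin N) (Fin N) ℂ)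
            (fun i => ((loopHol (Averaging.iter (fun i => blockAvg (P := P) (j := i) (expMeanLogSU (n := Fin N))) j U₀) c i : Matrix.specialUnitaryGroup (Fin N) ℂ) : Matrix (Fin N) (Fin N) ℂ))
            (fun i => covWalkSum (Averaging.iter (fun i => blockAvg (P := P) (j := i) (expMeanLogSU (n := Fin N))) j U₀) (pertVar (Averaging.iter (fun i => blockAvg (P := P) (j := i) (expMeanLogSU (n := Fin N))) j U₀) (Averaging.iter (fun i => blockAvg (P := P) (j := i) (expMeanLogSU (n := Fin N))) j W)) (walk (emb c.src) (loopWord P.L c.dir (off i.1) i.2.1 i.2.2))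
              * ((loopHol (Averaging.iter (fun i => blockAvg (P := P) (j := i) (expMeanLogSU (n := Fin N))) j U₀) c i : Matrix.specialUnitaryGroup (Fin N) ℂ) : Matrix (Fin N) (Fin N) ℂ))
            * star ((corr (expMeanLogSU (n := Fin N)) (Averaging.iter (fun i => blockAvg (P := P) (j := i) (expMeanLogSU (n := Fin N))) j U₀) c : Matrix.specialUnitaryGroup (Fin N) ℂ) : Matrix (Fin N) (Fin N) ℂ)
          + ((corr (expMeanLogSU (n := Fin N)) (Averaging.iter (fun i => blockAvg (P := P) (j := i) (expMeanLogSU (n := Fin N))) j U₀) c : Matrix.specialUnitaryGroup (Fin N) ℂ) : Matrix (Fin N) (Fin N) ℂ)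
            * covWalkSum (Averaging.iter (fun i => blockAvg (P := P) (j := i) (expMeanLogSU (n := Fin N))) j U₀) (pertVar (Averaging.iter (fun i => blockAvg (P := P) (j := i) (expMeanLogSU (n := Fin N))) j U₀) (Averaging.iter (fun i => blockAvg (P := P) (j := i) (expMeanLogSU (n := Fin N))) j W)) (walk (emb c.src) (List.replicate P.L (c.dir, true)))
            * star ((corr (expMeanLogSU (n := Fin N)) (Averaging.iter (fun i => blockAvg (P := P) (j := i) (expMeanLogSU (n := Fin N))) j U₀) c : Matrix.specialUnitaryGroup (Fin N) ℂ) : Matrix (Fin N) (Fin N) ℂ))))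
      (fun j c => by rw [add_sub_cancel]) (fun j c => hQs j _ c) j c
  have hD0 : ∀ b, (fun j => (pertVar (Averaging.iter (fun i => blockAvg (P := P) (j := i) (expMeanLogSU (n := Fin N))) j U₀) (Averaging.iter (fun i => blockAvg (P := P) (j := i) (expMeanLogSU (n := Fin N))) j W)) - Q j (pertVar U₀ W)) 0 b = 0 := by
    intro b
    simp only [Pi.sub_apply, hQ0]
    exact sub_self _
  -- the recursion families
  obtain ⟨G, hG0', hGs⟩ := exists_sourced_reduced_family (n := Fin N) U₀ (fun _ => (0 : Matrix (Fin N) (Fin N) ℂ)) (fun j c => ((pertVar (Averaging.iter (fun i => blockAvg (P := P) (j := i) (expMeanLogSU (n := Fin N))) (j + 1) U₀) (Averaging.iter (fun i => blockAvg (P := P) (j := i) (expMeanLogSU (n := Fin N))) (j + 1) W)) c - (fderiv ℂ (eml : (Idx P → Matrix (Fin N) (Fin N) ℂ) → Matrix (Fin N) (Fin N) ℂ)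
            (fun i => ((loopHol (Averaging.iter (fun i => blockAvg (P := P) (j := i) (expMeanLogSU (n := Fin N))) j U₀) c i : Matrix.specialUnitaryGroup (Fin N) ℂ) : Matrix (Fin N) (Fin N) ℂ))
            (fun i => covWalkSum (Averaging.iter (fun i => blockAvg (P := P) (j := i) (expMeanLogSU (n := Fin N))) j U₀) (pertVar (Averaging.iter (fun i => blockAvg (P := P) (j := i) (expMeanLogSU (n := Fin N))) j U₀) (Averaging.iter (fun i => blockAvg (P := P) (j := i) (expMeanLogSU (n := Fin N))) j W)) (walk (emb c.src) (loopWord P.L c.dir (off i.1) i.2.1 i.2.2))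
              * ((loopHol (Averaging.iter (fun i => blockAvg (P := P) (j := i) (expMeanLogSU (n := Fin N))) j U₀) c i : Matrix.specialUnitaryGroup (Fin N) ℂ) : Matrix (Fin N) (Fin N) ℂ))
            * star ((corr (expMeanLogSU (n := Fin N)) (Averaging.iter (fun i => blockAvg (P := P) (j := i) (expMeanLogSU (n := Fin N))) j U₀) c : Matrix.specialUnitaryGroup (Fin N) ℂ) : Matrix (Fin N) (Fin N) ℂ)
          + ((corr (expMeanLogSU (n := Fin N)) (Averaging.iter (fun i => blockAvg (P := P) (j := i) (expMeanLogSU (n := Fin N))) j U₀) c : Matrix.specialUnitaryGroup (Fin N) ℂ) : Matrix (Fin N) (Fin N) ℂ)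
            * covWalkSum (Averaging.iter (fun i => blockAvg (P := P) (j := i) (expMeanLogSU (n := Fin N))) j U₀) (pertVar (Averaging.iter (fun i => blockAvg (P := P) (j := i) (expMeanLogSU (n := Fin N))) j U₀) (Averaging.iter (fun i => blockAvg (P := P) (j := i) (expMeanLogSU (n := Fin N))) j W)) (walk (emb c.src) (List.replicate P.L (c.dir, true)))
            * star ((corr (expMeanLogSU (n := Fin N)) (Averaging.iter (fun i => blockAvg (P := P) (j := i) (expMeanLogSU (n := Fin N))) j U₀) c : Matrix.specialUnitaryGroup (Fin N) ℂ) : Matrix (Fin N) (Fin N) ℂ))))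
  have hG0 : ∀ b, G 0 b = 0 := fun b => hG0' b
  obtain ⟨Λ, hΛ0, hΛs⟩ := exists_coarseGauge_family U₀ G
  have hmain := sqrt_sum_normSq_sourced_le U₀ (fun j c => ((pertVar (Averaging.iter (fun i => blockAvg (P := P) (j := i) (expMeanLogSU (n := Fin N))) (j + 1) U₀) (Averaging.iter (fun i => blockAvg (P := P) (j := i) (expMeanLogSU (n := Fin N))) (j + 1) W)) c - (fderiv ℂ (eml : (Idx P → Matrix (Fin N) (Fin N) ℂ) → Matrix (Fin N) (Fin N) ℂ)
            (fun i => ((loopHol (Averaging.iter (fun i => blockAvg (P := P) (j := i) (expMeanLogSU (n := Fin N))) j U₀) c i : Matrix.specialUnitaryGroup (Fin N) ℂ) : Matrix (Fin N) (Fin N) ℂ))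
            (fun i => covWalkSum (Averaging.iter (fun i => blockAvg (P := P) (j := i) (expMeanLogSU (n := Fin N))) j U₀) (pertVar (Averaging.iter (fun i => blockAvg (P := P) (j := i) (expMeanLogSU (n := Fin N))) j U₀) (Averaging.iter (fun i => blockAvg (P := P) (j := i) (expMeanLogSU (n := Fin N))) j W)) (walk (emb c.src) (loopWord P.L c.dir (off i.1) i.2.1 i.2.2))
              * ((loopHol (Averaging.iter (fun i => blockAvg (P := P) (j := i) (expMeanLogSU (n := Fin N))) j U₀) c i : Matrix.specialUnitaryGroup (Fin N) ℂ) : Matrix (Fin N) (Fin N) ℂ))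
            * star ((corr (expMeanLogSU (n := Fin N)) (Averaging.iter (fun i => blockAvg (P := P) (j := i) (expMeanLogSU (n := Fin N))) j U₀) c : Matrix.specialUnitaryGroup (Fin N) ℂ) : Matrix (Fin N) (Fin N) ℂ)
          + ((corr (expMeanLogSU (n := Fin N)) (Averaging.iter (fun i => blockAvg (P := P) (j := i) (expMeanLogSU (n := Fin N))) j U₀) c : Matrix.specialUnitaryGroup (Fin N) ℂ) : Matrix (Fin N) (Fin N) ℂ)
            * covWalkSum (Averaging.iter (fun i => blockAvg (P := P) (j := i) (expMeanLogSU (n := Fin N))) j U₀) (pertVar (Averaging.iter (fun i => blockAvg (P := P) (j := i) (expMeanLogSU (n := Fin N))) j U₀) (Averaging.iter (fun i => blockAvg (P := P) (j := i) (expMeanLogSU (n := Fin N))) j W)) (walk (emb c.src) (List.replicate P.L (c.dir, true)))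
            * star ((corr (expMeanLogSU (n := Fin N)) (Averaging.iter (fun i => blockAvg (P := P) (j := i) (expMeanLogSU (n := Fin N))) j U₀) c : Matrix.specialUnitaryGroup (Fin N) ℂ) : Matrix (Fin N) (Fin N) ℂ)))) (fun j => (pertVar (Averaging.iter (fun i => blockAvg (P := P) (j := i) (expMeanLogSU (n := Fin N))) j U₀) (Averaging.iter (fun i => blockAvg (P := P) (j := i) (expMeanLogSU (n := Fin N))) j W)) - Q j (pertVar U₀ W)) hD0 hDs G hG0 hGs Λ hΛ0 hΛs
    a ha0 ha' hk hα ha24 haN hV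
  -- at level `k` the family IS `Y_k − Q k Y_0` (no fibre hypothesis used)
  have hlev : ∀ c : PBond P k, ‖(fun j => (pertVar (Averaging.iter (fun i => blockAvg (P := P) (j := i) (expMeanLogSU (n := Fin N))) j U₀) (Averaging.iter (fun i => blockAvg (P := P) (j := i) (expMeanLogSU (n := Fin N))) j W)) - Q j (pertVar U₀ W)) k c‖ = ‖(pertVar (Averaging.iter (fun i => blockAvg (P := P) (j := i) (expMeanLogSU (n := Fin N))) k U₀) (Averaging.iter (fun i => blockAvg (P := P) (j := i) (expMeanLogSU (n := Fin N))) k W)) c - Q k (pertVar U₀ W) c‖ := by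
    intro c
    simp only [Pi.sub_apply]
  simp only [hlev] at hmain
  -- the remainders through ★p1's one-step bound (monotonicity of the right-hand side)
  have hLpos : (0 : ℝ) < (P.L : ℝ) := by exact_mod_cast P.L_pos
  have hρ0 : 0 ≤ Real.sqrt (((P.L : ℝ) ^ P.d)⁻¹ * (P.L : ℝ) ^ 2) := Real.sqrt_nonneg _
  have hR : ∀ l < k, Real.sqrt (∑ c : PBond P (l + 1), ‖((pertVar (Averaging.iter (fun i => blockAvg (P := P) (j := i) (expMeanLogSU (n := Fin N))) (l + 1) U₀) (Averaging.iter (fun i => blockAvg (P := P) (j := i) (expMeanLogSU (n := Fin N))) (l + 1) W)) c - (fderiv ℂ (eml : (Idx P → Matrix (Fin N) (Fin N) ℂ) → Matrix (Fin N) (Fin N) ℂ)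
            (fun i => ((loopHol (Averaging.iter (fun i => blockAvg (P := P) (j := i) (expMeanLogSU (n := Fin N))) l U₀) c i : Matrix.specialUnitaryGroup (Fin N) ℂ) : Matrix (Fin N) (Fin N) ℂ))
            (fun i => covWalkSum (Averaging.iter (fun i => blockAvg (P := P) (j := i) (expMeanLogSU (n := Fin N))) l U₀) (pertVar (Averaging.iter (fun i => blockAvg (P := P) (j := i) (expMeanLogSU (n := Fin N))) l U₀) (Averaging.iter (fun i => blockAvg (P := P) (j := i) (expMeanLogSU (n := Fin N))) l W)) (walk (emb c.src) (loopWord P.L c.dir (off i.1) i.2.1 i.2.2))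
              * ((loopHol (Averaging.iter (fun i => blockAvg (P := P) (j := i) (expMeanLogSU (n := Fin N))) l U₀) c i : Matrix.specialUnitaryGroup (Fin N) ℂ) : Matrix (Fin N) (Fin N) ℂ))
            * star ((corr (expMeanLogSU (n := Fin N)) (Averaging.iter (fun i => blockAvg (P := P) (j := i) (expMeanLogSU (n := Fin N))) l U₀) c : Matrix.specialUnitaryGroup (Fin N) ℂ) : Matrix (Fin N) (Fin N) ℂ)
          + ((corr (expMeanLogSU (n := Fin N)) (Averaging.iter (fun i => blockAvg (P := P) (j := i) (expMeanLogSU (n := Fin N))) l U₀) c : Matrix.specialUnitaryGroup (Fin N) ℂ) : Matrix (Fin N) (Fin N) ℂ)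
            * covWalkSum (Averaging.iter (fun i => blockAvg (P := P) (j := i) (expMeanLogSU (n := Fin N))) l U₀) (pertVar (Averaging.iter (fun i => blockAvg (P := P) (j := i) (expMeanLogSU (n := Fin N))) l U₀) (Averaging.iter (fun i => blockAvg (P := P) (j := i) (expMeanLogSU (n := Fin N))) l W)) (walk (emb c.src) (List.replicate P.L (c.dir, true)))
            * star ((corr (expMeanLogSU (n := Fin N)) (Averaging.iter (fun i => blockAvg (P := P) (j := i) (expMeanLogSU (n := Fin N))) l U₀) c : Matrix.specialUnitaryGroup (Fin N) ℂ) : Matrix (Fin N) (Fin N) ℂ)))‖ ^ 2) ≤ 260 * Real.sqrt (∑ c : PBond P (l + 1), m l c ^ 4) :=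
    fun l hl => sqrt_sum_normSq_oneStep_remainder_le U₀ W l (m l) (hmL l hl) (hmS l hl) (hm72 l hl) (hα l hl) (ha24 l hl) (hmN l hl)
  have hS : ∀ j ≤ k, (∑ l ∈ Finset.range j, Real.sqrt (((P.L : ℝ) ^ P.d)⁻¹ * (P.L : ℝ) ^ 2) ^ (j - 1 - l) * Real.sqrt (∑ c : PBond P (l + 1), ‖((pertVar (Averaging.iter (fun i => blockAvg (P := P) (j := i) (expMeanLogSU (n := Fin N))) (l + 1) U₀) (Averaging.iter (fun i => blockAvg (P := P) (j := i) (expMeanLogSU (n := Fin N))) (l + 1) W)) c - (fderiv ℂ (eml : (Idx P → Matrix (Fin N) (Fin N) ℂ) → Matrix (Fin N) (Fin N) ℂ)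
            (fun i => ((loopHol (Averaging.iter (fun i => blockAvg (P := P) (j := i) (expMeanLogSU (n := Fin N))) l U₀) c i : Matrix.specialUnitaryGroup (Fin N) ℂ) : Matrix (Fin N) (Fin N) ℂ))
            (fun i => covWalkSum (Averaging.iter (fun i => blockAvg (P := P) (j := i) (expMeanLogSU (n := Fin N))) l U₀) (pertVar (Averaging.iter (fun i => blockAvg (P := P) (j := i) (expMeanLogSU (n := Fin N))) l U₀) (Averaging.iter (fun i => blockAvg (P := P) (j := i) (expMeanLogSU (n := Fin N))) l W)) (walk (emb c.src) (loopWord P.L c.dir (off i.1) i.2.1 i.2.2))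
              * ((loopHol (Averaging.iter (fun i => blockAvg (P := P) (j := i) (expMeanLogSU (n := Fin N))) l U₀) c i : Matrix.specialUnitaryGroup (Fin N) ℂ) : Matrix (Fin N) (Fin N) ℂ))
            * star ((corr (expMeanLogSU (n := Fin N)) (Averaging.iter (fun i => blockAvg (P := P) (j := i) (expMeanLogSU (n := Fin N))) l U₀) c : Matrix.specialUnitaryGroup (Fin N) ℂ) : Matrix (Fin N) (Fin N) ℂ)
          + ((corr (expMeanLogSU (n := Fin N)) (Averaging.iter (fun i => blockAvg (P := P) (j := i) (expMeanLogSU (n := Fin N))) l U₀) c : Matrix.specialUnitaryGroup (Fin N) ℂ) : Matrix (Fin N) (Fin N) ℂ)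
            * covWalkSum (Averaging.iter (fun i => blockAvg (P := P) (j := i) (expMeanLogSU (n := Fin N))) l U₀) (pertVar (Averaging.iter (fun i => blockAvg (P := P) (j := i) (expMeanLogSU (n := Fin N))) l U₀) (Averaging.iter (fun i => blockAvg (P := P) (j := i) (expMeanLogSU (n := Fin N))) l W)) (walk (emb c.src) (List.replicate P.L (c.dir, true)))
            * star ((corr (expMeanLogSU (n := Fin N)) (Averaging.iter (fun i => blockAvg (P := P) (j := i) (expMeanLogSU (n := Fin N))) l U₀) c : Matrix.specialUnitaryGroup (Fin N) ℂ) : Matrix (Fin N) (Fin N) ℂ)))‖ ^ 2))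
      ≤ (∑ l ∈ Finset.range j, Real.sqrt (((P.L : ℝ) ^ P.d)⁻¹ * (P.L : ℝ) ^ 2) ^ (j - 1 - l) * (260 * Real.sqrt (∑ c : PBond P (l + 1), m l c ^ 4))) := by
    intro j hj
    refine Finset.sum_le_sum fun l hl => ?_
    have hlk : l < k := (Finset.mem_range.mp hl).trans_le hj
    exact mul_le_mul_of_nonneg_left (hR l hlk) (pow_nonneg hρ0 _)
  have hE0 : ∀ j, 0 ≤ Real.exp ((159 * (((P.d + 2) * P.L : ℕ) : ℝ) * Real.sqrt (2 * P.d * (P.L : ℝ) ^ P.d * (2 * P.d))) / Real.sqrt (((P.L : ℝ) ^ P.d)⁻¹ * (P.L : ℝ) ^ 2) * ∑ i ∈ Finset.range j, a i) := fun j => (Real.exp_pos _).le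
  have hC0 : 0 ≤ Real.sqrt (4 * P.d * (((P.d : ℝ) + 2) ^ 2 * N * (P.L : ℝ) ^ 4) + (4 * ((P.d : ℝ) + 2) ^ 2 * (P.d : ℝ) ^ 3 * (3 * N + 2 * P.d) * (P.L : ℝ) ^ 6) * a' ^ 2) := Real.sqrt_nonneg _
  refine hmain.trans (add_le_add (mul_le_mul_of_nonneg_left (hS k le_rfl) (hE0 k)) ?_)
  refine mul_le_mul_of_nonneg_left (Finset.sum_le_sum fun j hj => ?_) (by positivity)
  exact mul_le_mul_of_nonneg_left (mul_le_mul_of_nonneg_left (hS j (Finset.mem_range.mp hj).le) (hE0 j)) hC0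

/-- ★ **THE SAME IN SUP × MASS FORM** (file C's reading): the per-level inputs are ANY bounds `μ_j` of the two-block masses `(d+2)L·Σ_{b∈N(c)}‖Y_j(b)‖ ≤ μ_j`
(`N(c) = {b : blockOf b₋ ∈ {c₋,c₊}}`; `72μ_j ≤ 1`, `3μ_j + a_j < δ_N`), and
`√(Σ_c‖Y_k(c) − Q k (pertVar U₀ W) c‖²) ≤ E_k·S_k + 2√d·Σ_{j<k}C_CM·(E_j·S_j)`, `S_j = Σ_{i<j}ρ^{j−1−i}·260·μ_i·((d+2)L·√((2dL^d)(2d))·√(Σ_b‖Y_i(b)‖²))`.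
[cite: Balaban1985Averaging, Prop. 3 (122)-(126) p.36; Balaban1987RG1, (0.3)-(0.4) pp.252-253; Balaban1985Variational, Prop. 7 p.299] -/
theorem sqrt_sum_normSq_levelRatio_sub_trueLinIter_le_mass (U₀ W : GaugeField P 0 (Matrix.specialUnitaryGroup (Fin N) ℂ)) {k : ℕ} (hk : k ≤ P.m + P.K)
    (Q : (k : ℕ) → (PBond P 0 → Matrix (Fin N) (Fin N) ℂ) → PBond P k → Matrix (Fin N) (Fin N) ℂ) (hQ0 : ∀ Y, Q 0 Y = Y)
    (hQs : ∀ (k : ℕ) (Y : PBond P 0 → Matrix (Fin N) (Fin N) ℂ) (c : PBond P (k + 1)), Q (k + 1) Y c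
      = (fderiv ℂ (eml : (Idx P → Matrix (Fin N) (Fin N) ℂ) → Matrix (Fin N) (Fin N) ℂ)
            (fun i => ((loopHol (Averaging.iter (fun i => blockAvg (P := P) (j := i) (expMeanLogSU (n := Fin N))) k U₀) c i : Matrix.specialUnitaryGroup (Fin N) ℂ) : Matrix (Fin N) (Fin N) ℂ))
            (fun i => covWalkSum (Averaging.iter (fun i => blockAvg (P := P) (j := i) (expMeanLogSU (n := Fin N))) k U₀) (Q k Y) (walk (emb c.src) (loopWord P.L c.dir (off i.1) i.2.1 i.2.2))
              * ((loopHol (Averaging.iter (fun i => blockAvg (P := P) (j := i) (expMeanLogSU (n := Fin N))) k U₀) c i : Matrix.specialUnitaryGroup (Fin N) ℂ) : Matrix (Fin N) (Fin N) ℂ))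
            * star ((corr (expMeanLogSU (n := Fin N)) (Averaging.iter (fun i => blockAvg (P := P) (j := i) (expMeanLogSU (n := Fin N))) k U₀) c : Matrix.specialUnitaryGroup (Fin N) ℂ) : Matrix (Fin N) (Fin N) ℂ)
          + ((corr (expMeanLogSU (n := Fin N)) (Averaging.iter (fun i => blockAvg (P := P) (j := i) (expMeanLogSU (n := Fin N))) k U₀) c : Matrix.specialUnitaryGroup (Fin N) ℂ) : Matrix (Fin N) (Fin N) ℂ)
            * covWalkSum (Averaging.iter (fun i => blockAvg (P := P) (j := i) (expMeanLogSU (n := Fin N))) k U₀) (Q k Y) (walk (emb c.src) (List.replicate P.L (c.dir, true)))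
            * star ((corr (expMeanLogSU (n := Fin N)) (Averaging.iter (fun i => blockAvg (P := P) (j := i) (expMeanLogSU (n := Fin N))) k U₀) c : Matrix.specialUnitaryGroup (Fin N) ℂ) : Matrix (Fin N) (Fin N) ℂ)))
    (a : ℕ → ℝ) (ha0 : ∀ j, 0 ≤ a j) {a' : ℝ} (ha' : 0 ≤ a')
    (hα : ∀ j < k, ∀ (c : PBond P (j + 1)) (i : Idx P), dist1 (loopHol (Averaging.iter (fun i => blockAvg (P := P) (j := i) (expMeanLogSU (n := Fin N))) j U₀) c i) ≤ a j)
    (ha24 : ∀ j < k, a j ≤ 1 / 24) (haN : ∀ j < k, a j < deltaSU (Fin N))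
    (hV : ∀ j < k, ∀ q : Plaq P j, dist1 (GaugeField.plaqHol (Averaging.iter (fun i => blockAvg (P := P) (j := i) (expMeanLogSU (n := Fin N))) j U₀) q) ≤ a')
    (μ : ℕ → ℝ) (hμ0 : ∀ j < k, 0 ≤ μ j)
    (hμ : ∀ j < k, ∀ c : PBond P (j + 1), (((P.d + 2) * P.L : ℕ) : ℝ) * ∑ b ∈ (univ.filter (fun b : PBond P j => blockOf b.src = c.src ∨ blockOf b.src = c.tgt)), ‖(pertVar (Averaging.iter (fun i => blockAvg (P := P) (j := i) (expMeanLogSU (n := Fin N))) j U₀) (Averaging.iter (fun i => blockAvg (P := P) (j := i) (expMeanLogSU (n := Fin N))) j W)) b‖ ≤ μ j)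
    (hμ72 : ∀ j < k, 72 * μ j ≤ 1) (hμN : ∀ j < k, 3 * μ j + a j < deltaSU (Fin N)) :
    Real.sqrt (∑ c : PBond P k, ‖(pertVar (Averaging.iter (fun i => blockAvg (P := P) (j := i) (expMeanLogSU (n := Fin N))) k U₀) (Averaging.iter (fun i => blockAvg (P := P) (j := i) (expMeanLogSU (n := Fin N))) k W)) c - Q k (pertVar U₀ W) c‖ ^ 2)
      ≤ Real.exp ((159 * (((P.d + 2) * P.L : ℕ) : ℝ) * Real.sqrt (2 * P.d * (P.L : ℝ) ^ P.d * (2 * P.d))) / Real.sqrt (((P.L : ℝ) ^ P.d)⁻¹ * (P.L : ℝ) ^ 2) * ∑ i ∈ Finset.range k, a i) * (∑ i ∈ Finset.range k, Real.sqrt (((P.L : ℝ) ^ P.d)⁻¹ * (P.L : ℝ) ^ 2) ^ (k - 1 - i) * (260 * (μ i * ((((P.d + 2) * P.L : ℕ) : ℝ) * Real.sqrt (2 * P.d * (P.L : ℝ) ^ P.d * (2 * P.d)) * Real.sqrt (∑ b : PBond P i, ‖(pertVar (Averaging.iter (fun i => blockAvg (P := P) (j := i) (expMeanLogSU (n :=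 Fin N))) i U₀) (Averaging.iter (fun i => blockAvg (P := P) (j := i) (expMeanLogSU (n := Fin N))) i W)) b‖ ^ 2)))))
        + 2 * Real.sqrt P.d * ∑ j ∈ Finset.range k, Real.sqrt (4 * P.d * (((P.d : ℝ) + 2) ^ 2 * N * (P.L : ℝ) ^ 4) + (4 * ((P.d : ℝ) + 2) ^ 2 * (P.d : ℝ) ^ 3 * (3 * N + 2 * P.d) * (P.L : ℝ) ^ 6) * a' ^ 2) * (Real.exp ((159 * (((P.d + 2) * P.L : ℕ) : ℝ) * Real.sqrt (2 * P.d * (P.L : ℝ) ^ P.d * (2 * P.d))) / Real.sqrt (((P.L : ℝ) ^ P.d)⁻¹ * (P.L : ℝ) ^ 2) * ∑ i ∈ Finset.range j, a i) * (∑ i ∈ Finset.range j, Real.sqrt (((P.L : ℝ) ^ P.d)⁻¹ * (P.L : ℝ) ^ 2) ^ (j - 1 - i) * (260 * (μ i * ((((P.d + 2) * P.L : ℕ) : ℝ) * Real.sqrt (2 * P.d * (P.L : ℝ) ^ P.d * (2 * P.d)) * Real.sqrt (∑ b : PBond P i, ‖(pertVar (Averaging.iter (fun i => blockAvg (P :=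 P) (j := i) (expMeanLogSU (n := Fin N))) i U₀) (Averaging.iter (fun i => blockAvg (P := P) (j := i) (expMeanLogSU (n := Fin N))) i W)) b‖ ^ 2)))))) := by
  -- §1 with the two-block walk masses
  have hB := sqrt_sum_normSq_levelRatio_sub_trueLinIter_le U₀ W hk Q hQ0 hQs a ha0 ha' hα ha24 haN hV
    (fun l c => (((P.d + 2) * P.L : ℕ) : ℝ) * ∑ b ∈ (univ.filter (fun b : PBond P l => blockOf b.src = c.src ∨ blockOf b.src = c.tgt)), ‖(pertVar (Averaging.iter (fun i => blockAvg (P := P) (j := i) (expMeanLogSU (n := Fin N))) l U₀) (Averaging.iter (fun i => blockAvg (P := P) (j := i) (expMeanLogSU (n := Fin N))) l W)) b‖)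
    (fun j hj c i => mass_loop_le (by omega) _ c i) (fun j hj c => mass_segment_le (by omega) _ c)
    (fun j hj c => by linarith [hμ j hj c, hμ72 j hj]) (fun j hj c => by linarith [hμ j hj c, hμN j hj])
  -- the `ℓ⁴` rows, level by level
  have hρ0 : 0 ≤ Real.sqrt (((P.L : ℝ) ^ P.d)⁻¹ * (P.L : ℝ) ^ 2) := Real.sqrt_nonneg _
  have h4 : ∀ l < k, Real.sqrt (∑ c : PBond P (l + 1), ((((P.d + 2) * P.L : ℕ) : ℝ) * ∑ b ∈ (univ.filter (fun b : PBond P l => blockOf b.src = c.src ∨ blockOf b.src = c.tgt)), ‖(pertVar (Averaging.iter (fun i => blockAvg (P := P) (j := i) (expMeanLogSU (n := Fin N))) l U₀) (Averaging.iter (fun i => blockAvg (P := P) (j := i) (expMeanLogSU (n := Fin N))) l W)) b‖) ^ 4)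
      ≤ μ l * ((((P.d + 2) * P.L : ℕ) : ℝ) * Real.sqrt (2 * P.d * (P.L : ℝ) ^ P.d * (2 * P.d)) * Real.sqrt (∑ b : PBond P l, ‖(pertVar (Averaging.iter (fun i => blockAvg (P := P) (j := i) (expMeanLogSU (n := Fin N))) l U₀) (Averaging.iter (fun i => blockAvg (P := P) (j := i) (expMeanLogSU (n := Fin N))) l W)) b‖ ^ 2)) :=
    fun l hl => sqrt_sum_nbhdMass_pow_four_le (N := N) (by omega) _ (hμ0 l hl) (hμ l hl)
  have hS : ∀ j ≤ k,
      (∑ l ∈ Finset.range j, Real.sqrt (((P.L : ℝ) ^ P.d)⁻¹ * (P.L : ℝ) ^ 2) ^ (j - 1 - l) * (260 * Real.sqrt (∑ c : PBond P (l + 1),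
          ((((P.d + 2) * P.L : ℕ) : ℝ) * ∑ b ∈ (univ.filter (fun b : PBond P l => blockOf b.src = c.src ∨ blockOf b.src = c.tgt)), ‖(pertVar (Averaging.iter (fun i => blockAvg (P := P) (j := i) (expMeanLogSU (n := Fin N))) l U₀) (Averaging.iter (fun i => blockAvg (P := P) (j := i) (expMeanLogSU (n := Fin N))) l W)) b‖) ^ 4)))
        ≤ (∑ l ∈ Finset.range j, Real.sqrt (((P.L : ℝ) ^ P.d)⁻¹ * (P.L : ℝ) ^ 2) ^ (j - 1 - l) * (260 * (μ l * ((((P.d + 2) * P.L : ℕ) : ℝ) * Real.sqrt (2 * P.d * (P.L : ℝ) ^ P.d * (2 * P.d)) * Real.sqrt (∑ b : PBond P l, ‖(pertVar (Averaging.iter (fun i => blockAvg (P := P) (j := i) (expMeanLogSU (n := Fin N))) l U₀) (Averaging.iter (fun i => blockAvg (P := P) (j := i) (expMeanLogSU (n := Fin N))) l W)) b‖ ^ 2))))) := by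
    intro j hj
    refine Finset.sum_le_sum fun l hl => ?_
    have hlk : l < k := (Finset.mem_range.mp hl).trans_le hj
    exact mul_le_mul_of_nonneg_left (mul_le_mul_of_nonneg_left (h4 l hlk) (by norm_num)) (pow_nonneg hρ0 _)
  have hE0 : ∀ j, 0 ≤ Real.exp ((159 * (((P.d + 2) * P.L : ℕ) : ℝ) * Real.sqrt (2 * P.d * (P.L : ℝ) ^ P.d * (2 * P.d))) / Real.sqrt (((P.L : ℝ) ^ P.d)⁻¹ * (P.L : ℝ) ^ 2) * ∑ i ∈ Finset.range j, a i) := fun j => (Real.exp_pos _).le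
  have hC0 : 0 ≤ Real.sqrt (4 * P.d * (((P.d : ℝ) + 2) ^ 2 * N * (P.L : ℝ) ^ 4) + (4 * ((P.d : ℝ) + 2) ^ 2 * (P.d : ℝ) ^ 3 * (3 * N + 2 * P.d) * (P.L : ℝ) ^ 6) * a' ^ 2) := Real.sqrt_nonneg _
  refine hB.trans (add_le_add (mul_le_mul_of_nonneg_left (hS k le_rfl) (hE0 k)) ?_)
  refine mul_le_mul_of_nonneg_left (Finset.sum_le_sum fun j hj => ?_) (by positivity)
  exact mul_le_mul_of_nonneg_left (mul_le_mul_of_nonneg_left (hS j (Finset.mem_range.mp hj).le) (hE0 j)) hC0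

/-! ## §2 ★ The true linearised iterate of a generic `Y` in `ℓ²`, through the structure theorem -/

/-- ★ **THE TRUE LINEARISED ITERATE IN `ℓ²` = REDUCED PART + COARSE GAUGE FUNCTION.**  For the recursion families of record (`G 0 = Y`, `G (j+1) = T_jG_j − P(CM_jG_j)`;
`S 0 = Y`, `S (j+1) = LINE_j(S_j)`; `Λ 0 = 0`, `Λ (j+1) z = CM_j(G_j)(z) + Λ_j(emb z)` — zero content, displayed as in the fibre core) along the tower `Ū₀^{(j)}`, `k ≤ m + K`,
per-level loop sizes `dist1(W^{(j)}_i(c)) ≤ a j ≤ 1/24`, `a j < δ_N` (`j < k`):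
`√(Σ_c‖Q k Y c‖²) ≤ ρᵏ·E_k·√(Σ_b‖Y b‖²) + 2√d·√(Σ_y‖Λ k y‖²)`, `ρ = √((L^d)⁻¹L²)`, `E_k = exp((κ/ρ)Σ_{j<k}a j)`.
(✓ `trueLinIter_structure`: `Q k Y = G_k + P_{Ū₀^{(k)}}Λ_k`; ✓ `sqrt_sum_normSq_reduced_sub_lineIter_le`.2: `‖G_k‖_{ℓ²} ≤ ρᵏE_k‖Y‖_{ℓ²}`; Minkowski.)
[cite: Balaban1984PropagatorsI, (1.18)-(1.20) pp.19-20; Balaban1985Averaging, Prop. 3 (124)-(126) p.36] -/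
theorem sqrt_sum_normSq_trueLinIter_le_of_structure (U₀ : GaugeField P 0 (Matrix.specialUnitaryGroup (Fin N) ℂ)) {k : ℕ} (hk : k ≤ P.m + P.K)
    (Q : (k : ℕ) → (PBond P 0 → Matrix (Fin N) (Fin N) ℂ) → PBond P k → Matrix (Fin N) (Fin N) ℂ) (hQ0 : ∀ Y, Q 0 Y = Y)
    (hQs : ∀ (k : ℕ) (Y : PBond P 0 → Matrix (Fin N) (Fin N) ℂ) (c : PBond P (k + 1)), Q (k + 1) Y c
      = (fderiv ℂ (eml : (Idx P → Matrix (Fin N) (Fin N) ℂ) → Matrix (Fin N) (Fin N) ℂ)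
            (fun i => ((loopHol (Averaging.iter (fun i => blockAvg (P := P) (j := i) (expMeanLogSU (n := Fin N))) k U₀) c i : Matrix.specialUnitaryGroup (Fin N) ℂ) : Matrix (Fin N) (Fin N) ℂ))
            (fun i => covWalkSum (Averaging.iter (fun i => blockAvg (P := P) (j := i) (expMeanLogSU (n := Fin N))) k U₀) (Q k Y) (walk (emb c.src) (loopWord P.L c.dir (off i.1) i.2.1 i.2.2))
              * ((loopHol (Averaging.iter (fun i => blockAvg (P := P) (j := i) (expMeanLogSU (n := Fin N))) k U₀) c i : Matrix.specialUnitaryGroup (Fin N) ℂ) : Matrix (Fin N) (Fin N) ℂ))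
            * star ((corr (expMeanLogSU (n := Fin N)) (Averaging.iter (fun i => blockAvg (P := P) (j := i) (expMeanLogSU (n := Fin N))) k U₀) c : Matrix.specialUnitaryGroup (Fin N) ℂ) : Matrix (Fin N) (Fin N) ℂ)
          + ((corr (expMeanLogSU (n := Fin N)) (Averaging.iter (fun i => blockAvg (P := P) (j := i) (expMeanLogSU (n := Fin N))) k U₀) c : Matrix.specialUnitaryGroup (Fin N) ℂ) : Matrix (Fin N) (Fin N) ℂ)
            * covWalkSum (Averaging.iter (fun i => blockAvg (P := P) (j := i) (expMeanLogSU (n := Fin N))) k U₀) (Q k Y) (walk (emb c.src) (List.replicate P.L (c.dir, true)))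
            * star ((corr (expMeanLogSU (n := Fin N)) (Averaging.iter (fun i => blockAvg (P := P) (j := i) (expMeanLogSU (n := Fin N))) k U₀) c : Matrix.specialUnitaryGroup (Fin N) ℂ) : Matrix (Fin N) (Fin N) ℂ)))
    (Y : PBond P 0 → Matrix (Fin N) (Fin N) ℂ)
    (G S : (k : ℕ) → PBond P k → Matrix (Fin N) (Fin N) ℂ) (Λ : (k : ℕ) → Site P k → Matrix (Fin N) (Fin N) ℂ)
    (hG0 : ∀ b, G 0 b = Y b) (hS0 : ∀ b, S 0 b = Y b) (hΛ0 : ∀ x, Λ 0 x = 0)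
    (hΛs : ∀ (k : ℕ) (z : Site P (k + 1)), Λ (k + 1) z
      = (((Fintype.card (Idx P) : ℂ))⁻¹ • ∑ i : Idx P,
              covWalkSum (Averaging.iter (fun i => blockAvg (P := P) (j := i) (expMeanLogSU (n := Fin N))) k U₀) (G k) (walk (emb z) (stairWord i.2.1 (off i.1))))
        + Λ k (emb z))
    (hGs : ∀ (k : ℕ) (c : PBond P (k + 1)), G (k + 1) c
      = (fderiv ℂ (eml : (Idx P → Matrix (Fin N) (Fin N) ℂ) → Matrix (Fin N) (Fin N) ℂ)
            (fun i => ((loopHol (Averaging.iter (fun i => blockAvg (P := P) (j := i) (expMeanLogSU (n := Fin N))) k U₀) c i : Matrix.specialUnitaryGroup (Fin N) ℂ) : Matrix (Fin N) (Fin N) ℂ))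
            (fun i => covWalkSum (Averaging.iter (fun i => blockAvg (P := P) (j := i) (expMeanLogSU (n := Fin N))) k U₀) (G k) (walk (emb c.src) (loopWord P.L c.dir (off i.1) i.2.1 i.2.2))
              * ((loopHol (Averaging.iter (fun i => blockAvg (P := P) (j := i) (expMeanLogSU (n := Fin N))) k U₀) c i : Matrix.specialUnitaryGroup (Fin N) ℂ) : Matrix (Fin N) (Fin N) ℂ))
            * star ((corr (expMeanLogSU (n := Fin N)) (Averaging.iter (fun i => blockAvg (P := P) (j := i) (expMeanLogSU (n := Fin N))) k U₀) c : Matrix.specialUnitaryGroup (Fin N) ℂ) : Matrix (Fin N) (Fin N) ℂ)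
          + ((corr (expMeanLogSU (n := Fin N)) (Averaging.iter (fun i => blockAvg (P := P) (j := i) (expMeanLogSU (n := Fin N))) k U₀) c : Matrix.specialUnitaryGroup (Fin N) ℂ) : Matrix (Fin N) (Fin N) ℂ)
            * covWalkSum (Averaging.iter (fun i => blockAvg (P := P) (j := i) (expMeanLogSU (n := Fin N))) k U₀) (G k) (walk (emb c.src) (List.replicate P.L (c.dir, true)))
            * star ((corr (expMeanLogSU (n := Fin N)) (Averaging.iter (fun i => blockAvg (P := P) (j := i) (expMeanLogSU (n := Fin N))) k U₀) c : Matrix.specialUnitaryGroup (Fin N) ℂ) : Matrix (Fin N) (Fin N) ℂ))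
        - ((((Fintype.card (Idx P) : ℂ))⁻¹ • ∑ i : Idx P,
              covWalkSum (Averaging.iter (fun i => blockAvg (P := P) (j := i) (expMeanLogSU (n := Fin N))) k U₀) (G k) (walk (emb c.src) (stairWord i.2.1 (off i.1))))
            - ((Averaging.iter (fun i => blockAvg (P := P) (j := i) (expMeanLogSU (n := Fin N))) (k + 1) U₀ c : Matrix.specialUnitaryGroup (Fin N) ℂ) : Matrix (Fin N) (Fin N) ℂ)
              * (((Fintype.card (Idx P) : ℂ))⁻¹ • ∑ i : Idx P,
              covWalkSum (Averaging.iter (fun i => blockAvg (P := P) (j := i) (expMeanLogSU (n := Fin N))) k U₀) (G k) (walk (emb c.tgt) (stairWord i.2.1 (off i.1))))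
              * star ((Averaging.iter (fun i => blockAvg (P := P) (j := i) (expMeanLogSU (n := Fin N))) (k + 1) U₀ c : Matrix.specialUnitaryGroup (Fin N) ℂ) : Matrix (Fin N) (Fin N) ℂ)))
    (hSs : ∀ (k : ℕ) (c : PBond P (k + 1)), S (k + 1) c
      = ((Fintype.card (Idx P) : ℂ))⁻¹ • ∑ i : Idx P,
          ((holAt (Averaging.iter (fun i => blockAvg (P := P) (j := i) (expMeanLogSU (n := Fin N))) k U₀) (walk (emb c.src) (stairWord i.2.1 (off i.1))) : Matrix.specialUnitaryGroup (Fin N) ℂ) : Matrix (Fin N) (Fin N) ℂ) *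
            covWalkSum (Averaging.iter (fun i => blockAvg (P := P) (j := i) (expMeanLogSU (n := Fin N))) k U₀) (S k)
              (walk (walkEnd (emb c.src) (stairWord i.2.1 (off i.1))) (List.replicate P.L (c.dir, true))) *
          star ((holAt (Averaging.iter (fun i => blockAvg (P := P) (j := i) (expMeanLogSU (n := Fin N))) k U₀) (walk (emb c.src) (stairWord i.2.1 (off i.1))) : Matrix.specialUnitaryGroup (Fin N) ℂ) : Matrix (Fin N) (Fin N) ℂ))
    (a : ℕ → ℝ) (ha0 : ∀ j, 0 ≤ a j)
    (hα : ∀ j < k, ∀ (c : PBond P (j + 1)) (i : Idx P), dist1 (loopHol (Averaging.iter (fun i => blockAvg (P := P) (j := i) (expMeanLogSU (n := Fin N))) j U₀) c i) ≤ a j)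
    (ha24 : ∀ j < k, a j ≤ 1 / 24) (haN : ∀ j < k, a j < deltaSU (Fin N)) :
    Real.sqrt (∑ c : PBond P k, ‖Q k Y c‖ ^ 2)
      ≤ Real.sqrt (((P.L : ℝ) ^ P.d)⁻¹ * (P.L : ℝ) ^ 2) ^ k * Real.exp ((159 * (((P.d + 2) * P.L : ℕ) : ℝ) * Real.sqrt (2 * P.d * (P.L : ℝ) ^ P.d * (2 * P.d))) / Real.sqrt (((P.L : ℝ) ^ P.d)⁻¹ * (P.L : ℝ) ^ 2) * ∑ i ∈ Finset.range k, a i) * Real.sqrt (∑ b : PBond P 0, ‖Y b‖ ^ 2)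
        + 2 * Real.sqrt P.d * Real.sqrt (∑ y : Site P k, ‖Λ k y‖ ^ 2) := by
  -- the (0.4) guards from the loop sizes
  have hg : ∀ j < k, ∀ (c : PBond P (j + 1)) (i : Idx P),
      dist1 (loopHol (Averaging.iter (fun i => blockAvg (P := P) (j := i) (expMeanLogSU (n := Fin N))) j U₀) c i) < deltaSU (Fin N) :=
    fun j hj c i => (hα j hj c i).trans_lt (haN j hj)
  -- the structure identity, pointwise, and the triangle inequality
  have hpt : ∀ c : PBond P k, ‖Q k Y c‖ ≤ ‖G k c‖ + (‖Λ k c.src‖ + ‖Λ k c.tgt‖) := fun c => by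
    have h := trueLinIter_structure U₀ Q hQ0 hQs Y
      (fun k Gk z => ((Fintype.card (Idx P) : ℂ))⁻¹ • ∑ i : Idx P,
        covWalkSum (Averaging.iter (fun i => blockAvg (P := P) (j := i) (expMeanLogSU (n := Fin N))) k U₀) Gk (walk (emb z) (stairWord i.2.1 (off i.1))))
      G Λ hG0 hΛ0 hΛs hGs k hg c
    rw [h]
    exact (norm_add_le _ _).trans (add_le_add le_rfl (norm_pureGauge_le _ (Λ k) c))
  have h1 : Real.sqrt (∑ c : PBond P k, ‖Q k Y c‖ ^ 2) ≤ Real.sqrt (∑ c : PBond P k, (‖G k c‖ + (‖Λ k c.src‖ + ‖Λ k c.tgt‖)) ^ 2) :=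
    Real.sqrt_le_sqrt (Finset.sum_le_sum fun c _ => pow_le_pow_left₀ (norm_nonneg _) (hpt c) 2)
  have h2 := sqrt_sum_sq_add_le (Finset.univ : Finset (PBond P k)) (fun c => ‖G k c‖) (fun c => ‖Λ k c.src‖ + ‖Λ k c.tgt‖)
    (fun c _ => norm_nonneg _) (fun c _ => by positivity)
  -- `√Σ_c(‖Λ c₋‖ + ‖Λ c₊‖)² ≤ 2√d·√Σ_y‖Λ y‖²`
  have h3sq : ∑ c : PBond P k, (‖Λ k c.src‖ + ‖Λ k c.tgt‖) ^ 2 ≤ 4 * P.d * ∑ y : Site P k, ‖Λ k y‖ ^ 2 := by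
    calc ∑ c : PBond P k, (‖Λ k c.src‖ + ‖Λ k c.tgt‖) ^ 2 ≤ ∑ c : PBond P k, 2 * (‖Λ k c.tgt‖ ^ 2 + ‖Λ k c.src‖ ^ 2) :=
          Finset.sum_le_sum fun c _ => by nlinarith [sq_nonneg (‖Λ k c.src‖ - ‖Λ k c.tgt‖)]
      _ = 4 * P.d * ∑ y : Site P k, ‖Λ k y‖ ^ 2 := by rw [← Finset.mul_sum, sum_pbond_tgt_add_src (fun y => ‖Λ k y‖ ^ 2)]; ring
  have hd0 : (0 : ℝ) ≤ P.d := Nat.cast_nonneg _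
  have h3 : Real.sqrt (∑ c : PBond P k, (‖Λ k c.src‖ + ‖Λ k c.tgt‖) ^ 2) ≤ 2 * Real.sqrt P.d * Real.sqrt (∑ y : Site P k, ‖Λ k y‖ ^ 2) := by
    refine (Real.sqrt_le_sqrt h3sq).trans (le_of_eq ?_)
    rw [show (4 : ℝ) * P.d * ∑ y : Site P k, ‖Λ k y‖ ^ 2 = 2 ^ 2 * ((P.d : ℝ) * ∑ y : Site P k, ‖Λ k y‖ ^ 2) by ring,
      Real.sqrt_mul (by norm_num), Real.sqrt_sq (by norm_num), Real.sqrt_mul hd0]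
    ring
  -- the reduced row (conjunct 2 of ✓ `sqrt_sum_normSq_reduced_sub_lineIter_le`)
  have hG := (sqrt_sum_normSq_reduced_sub_lineIter_le (n := Fin N) U₀ Y G S hG0 hS0 hGs hSs a ha0 hk hα ha24 haN).2
  linarith [h1, h2, h3, hG]

/-! ## §3 ★★ The `ℓ²` mass of the nonlinear level ratio field -/

/-- ★★ **THE `ℓ²` MASS OF THE LEVEL-`k` RATIO FIELD OF THE NONLINEAR PAIR `(U₀, W)`**: `U₀, W ∈ SU(N)`, `k ≤ m + K`; `Q` the true linearised iterate (`hQ0`, `hQs`);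
`G, S, Λ` the recursion families of record at `Y := pertVar U₀ W` (zero content, displayed); tower sizes `a` (loop variables, `≤ 1/24`, `< δ_N`), `a′` (plaquettes); per-level
two-block sup bounds `μ_j` (`72μ_j ≤ 1`, `3μ_j + a_j < δ_N`) for `j < k`.  Then
`‖Y_k‖_{ℓ²} ≤ ρᵏE_k‖Y‖_{ℓ²} + 2√d‖Λ_k‖_{ℓ²} + E_k·S_k + 2√d·Σ_{j<k}C_CM·(E_j·S_j)`, `S_j = Σ_{i<j}ρ^{j−1−i}·260·μ_i·((d+2)L√((2dL^d)(2d))·‖Y_i‖_{ℓ²})` — the masses on the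
right only at levels `i < k` (triangular).  [cite: Balaban1985Averaging, Prop. 3 (122)-(126) p.36; Balaban1984PropagatorsI, (1.18)-(1.20) pp.19-20; Balaban1985Variational, (15) p.280, Prop. 7 p.299] -/
theorem sqrt_sum_normSq_levelRatio_le (U₀ W : GaugeField P 0 (Matrix.specialUnitaryGroup (Fin N) ℂ)) {k : ℕ} (hk : k ≤ P.m + P.K)
    (Q : (k : ℕ) → (PBond P 0 → Matrix (Fin N) (Fin N) ℂ) → PBond P k → Matrix (Fin N) (Fin N) ℂ) (hQ0 : ∀ Y, Q 0 Y = Y)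
    (hQs : ∀ (k : ℕ) (Y : PBond P 0 → Matrix (Fin N) (Fin N) ℂ) (c : PBond P (k + 1)), Q (k + 1) Y c
      = (fderiv ℂ (eml : (Idx P → Matrix (Fin N) (Fin N) ℂ) → Matrix (Fin N) (Fin N) ℂ)
            (fun i => ((loopHol (Averaging.iter (fun i => blockAvg (P := P) (j := i) (expMeanLogSU (n := Fin N))) k U₀) c i : Matrix.specialUnitaryGroup (Fin N) ℂ) : Matrix (Fin N) (Fin N) ℂ))
            (fun i => covWalkSum (Averaging.iter (fun i => blockAvg (P := P) (j := i) (expMeanLogSU (n := Fin N))) k U₀) (Q k Y) (walk (emb c.src) (loopWord P.L c.dir (off i.1) i.2.1 i.2.2))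
              * ((loopHol (Averaging.iter (fun i => blockAvg (P := P) (j := i) (expMeanLogSU (n := Fin N))) k U₀) c i : Matrix.specialUnitaryGroup (Fin N) ℂ) : Matrix (Fin N) (Fin N) ℂ))
            * star ((corr (expMeanLogSU (n := Fin N)) (Averaging.iter (fun i => blockAvg (P := P) (j := i) (expMeanLogSU (n := Fin N))) k U₀) c : Matrix.specialUnitaryGroup (Fin N) ℂ) : Matrix (Fin N) (Fin N) ℂ)
          + ((corr (expMeanLogSU (n := Fin N)) (Averaging.iter (fun i => blockAvg (P := P) (j := i) (expMeanLogSU (n := Fin N))) k U₀) c : Matrix.specialUnitaryGroup (Fin N) ℂ) : Matrix (Fin N) (Fin N) ℂ)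
            * covWalkSum (Averaging.iter (fun i => blockAvg (P := P) (j := i) (expMeanLogSU (n := Fin N))) k U₀) (Q k Y) (walk (emb c.src) (List.replicate P.L (c.dir, true)))
            * star ((corr (expMeanLogSU (n := Fin N)) (Averaging.iter (fun i => blockAvg (P := P) (j := i) (expMeanLogSU (n := Fin N))) k U₀) c : Matrix.specialUnitaryGroup (Fin N) ℂ) : Matrix (Fin N) (Fin N) ℂ)))
    (G S : (k : ℕ) → PBond P k → Matrix (Fin N) (Fin N) ℂ) (Λ : (k : ℕ) → Site P k → Matrix (Fin N) (Fin N) ℂ)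
    (hG0 : ∀ b, G 0 b = pertVar U₀ W b) (hS0 : ∀ b, S 0 b = pertVar U₀ W b) (hΛ0 : ∀ x, Λ 0 x = 0)
    (hΛs : ∀ (k : ℕ) (z : Site P (k + 1)), Λ (k + 1) z
      = (((Fintype.card (Idx P) : ℂ))⁻¹ • ∑ i : Idx P,
              covWalkSum (Averaging.iter (fun i => blockAvg (P := P) (j := i) (expMeanLogSU (n := Fin N))) k U₀) (G k) (walk (emb z) (stairWord i.2.1 (off i.1))))
        + Λ k (emb z))
    (hGs : ∀ (k : ℕ) (c : PBond P (k + 1)), G (k + 1) c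
      = (fderiv ℂ (eml : (Idx P → Matrix (Fin N) (Fin N) ℂ) → Matrix (Fin N) (Fin N) ℂ)
            (fun i => ((loopHol (Averaging.iter (fun i => blockAvg (P := P) (j := i) (expMeanLogSU (n := Fin N))) k U₀) c i : Matrix.specialUnitaryGroup (Fin N) ℂ) : Matrix (Fin N) (Fin N) ℂ))
            (fun i => covWalkSum (Averaging.iter (fun i => blockAvg (P := P) (j := i) (expMeanLogSU (n := Fin N))) k U₀) (G k) (walk (emb c.src) (loopWord P.L c.dir (off i.1) i.2.1 i.2.2))
              * ((loopHol (Averaging.iter (fun i => blockAvg (P := P) (j := i) (expMeanLogSU (n := Fin N))) k U₀) c i : Matrix.specialUnitaryGroup (Fin N) ℂ) : Matrix (Fin N) (Fin N) ℂ))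
            * star ((corr (expMeanLogSU (n := Fin N)) (Averaging.iter (fun i => blockAvg (P := P) (j := i) (expMeanLogSU (n := Fin N))) k U₀) c : Matrix.specialUnitaryGroup (Fin N) ℂ) : Matrix (Fin N) (Fin N) ℂ)
          + ((corr (expMeanLogSU (n := Fin N)) (Averaging.iter (fun i => blockAvg (P := P) (j := i) (expMeanLogSU (n := Fin N))) k U₀) c : Matrix.specialUnitaryGroup (Fin N) ℂ) : Matrix (Fin N) (Fin N) ℂ)
            * covWalkSum (Averaging.iter (fun i => blockAvg (P := P) (j := i) (expMeanLogSU (n := Fin N))) k U₀) (G k) (walk (emb c.src) (List.replicate P.L (c.dir, true)))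
            * star ((corr (expMeanLogSU (n := Fin N)) (Averaging.iter (fun i => blockAvg (P := P) (j := i) (expMeanLogSU (n := Fin N))) k U₀) c : Matrix.specialUnitaryGroup (Fin N) ℂ) : Matrix (Fin N) (Fin N) ℂ))
        - ((((Fintype.card (Idx P) : ℂ))⁻¹ • ∑ i : Idx P,
              covWalkSum (Averaging.iter (fun i => blockAvg (P := P) (j := i) (expMeanLogSU (n := Fin N))) k U₀) (G k) (walk (emb c.src) (stairWord i.2.1 (off i.1))))
            - ((Averaging.iter (fun i => blockAvg (P := P) (j := i) (expMeanLogSU (n := Fin N))) (k + 1) U₀ c : Matrix.specialUnitaryGroup (Fin N) ℂ) : Matrix (Fin N) (Fin N) ℂ)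
              * (((Fintype.card (Idx P) : ℂ))⁻¹ • ∑ i : Idx P,
              covWalkSum (Averaging.iter (fun i => blockAvg (P := P) (j := i) (expMeanLogSU (n := Fin N))) k U₀) (G k) (walk (emb c.tgt) (stairWord i.2.1 (off i.1))))
              * star ((Averaging.iter (fun i => blockAvg (P := P) (j := i) (expMeanLogSU (n := Fin N))) (k + 1) U₀ c : Matrix.specialUnitaryGroup (Fin N) ℂ) : Matrix (Fin N) (Fin N) ℂ)))
    (hSs : ∀ (k : ℕ) (c : PBond P (k + 1)), S (k + 1) c
      = ((Fintype.card (Idx P) : ℂ))⁻¹ • ∑ i : Idx P,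
          ((holAt (Averaging.iter (fun i => blockAvg (P := P) (j := i) (expMeanLogSU (n := Fin N))) k U₀) (walk (emb c.src) (stairWord i.2.1 (off i.1))) : Matrix.specialUnitaryGroup (Fin N) ℂ) : Matrix (Fin N) (Fin N) ℂ) *
            covWalkSum (Averaging.iter (fun i => blockAvg (P := P) (j := i) (expMeanLogSU (n := Fin N))) k U₀) (S k)
              (walk (walkEnd (emb c.src) (stairWord i.2.1 (off i.1))) (List.replicate P.L (c.dir, true))) *
          star ((holAt (Averaging.iter (fun i => blockAvg (P := P) (j := i) (expMeanLogSU (n := Fin N))) k U₀) (walk (emb c.src) (stairWord i.2.1 (off i.1))) : Matrix.specialUnitaryGroup (Fin N) ℂ) : Matrix (Fin N) (Fin N) ℂ))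
    (a : ℕ → ℝ) (ha0 : ∀ j, 0 ≤ a j) {a' : ℝ} (ha' : 0 ≤ a')
    (hα : ∀ j < k, ∀ (c : PBond P (j + 1)) (i : Idx P), dist1 (loopHol (Averaging.iter (fun i => blockAvg (P := P) (j := i) (expMeanLogSU (n := Fin N))) j U₀) c i) ≤ a j)
    (ha24 : ∀ j < k, a j ≤ 1 / 24) (haN : ∀ j < k, a j < deltaSU (Fin N))
    (hV : ∀ j < k, ∀ q : Plaq P j, dist1 (GaugeField.plaqHol (Averaging.iter (fun i => blockAvg (P := P) (j := i) (expMeanLogSU (n := Fin N))) j U₀) q) ≤ a')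
    (μ : ℕ → ℝ) (hμ0 : ∀ j < k, 0 ≤ μ j)
    (hμ : ∀ j < k, ∀ c : PBond P (j + 1), (((P.d + 2) * P.L : ℕ) : ℝ) * ∑ b ∈ (univ.filter (fun b : PBond P j => blockOf b.src = c.src ∨ blockOf b.src = c.tgt)), ‖(pertVar (Averaging.iter (fun i => blockAvg (P := P) (j := i) (expMeanLogSU (n := Fin N))) j U₀) (Averaging.iter (fun i => blockAvg (P := P) (j := i) (expMeanLogSU (n := Fin N))) j W)) b‖ ≤ μ j)
    (hμ72 : ∀ j < k, 72 * μ j ≤ 1) (hμN : ∀ j < k, 3 * μ j + a j < deltaSU (Fin N)) :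
    Real.sqrt (∑ b : PBond P k, ‖(pertVar (Averaging.iter (fun i => blockAvg (P := P) (j := i) (expMeanLogSU (n := Fin N))) k U₀) (Averaging.iter (fun i => blockAvg (P := P) (j := i) (expMeanLogSU (n := Fin N))) k W)) b‖ ^ 2)
      ≤ Real.sqrt (((P.L : ℝ) ^ P.d)⁻¹ * (P.L : ℝ) ^ 2) ^ k * Real.exp ((159 * (((P.d + 2) * P.L : ℕ) : ℝ) * Real.sqrt (2 * P.d * (P.L : ℝ) ^ P.d * (2 * P.d))) / Real.sqrt (((P.L : ℝ) ^ P.d)⁻¹ * (P.L : ℝ) ^ 2) * ∑ i ∈ Finset.range k, a i) * Real.sqrt (∑ b : PBond P 0, ‖pertVar U₀ W b‖ ^ 2)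
        + 2 * Real.sqrt P.d * Real.sqrt (∑ y : Site P k, ‖Λ k y‖ ^ 2)
        + (Real.exp ((159 * (((P.d + 2) * P.L : ℕ) : ℝ) * Real.sqrt (2 * P.d * (P.L : ℝ) ^ P.d * (2 * P.d))) / Real.sqrt (((P.L : ℝ) ^ P.d)⁻¹ * (P.L : ℝ) ^ 2) * ∑ i ∈ Finset.range k, a i) * (∑ i ∈ Finset.range k, Real.sqrt (((P.L : ℝ) ^ P.d)⁻¹ * (P.L : ℝ) ^ 2) ^ (k - 1 - i) * (260 * (μ i * ((((P.d + 2) * P.L : ℕ) : ℝ) * Real.sqrt (2 * P.d * (P.L : ℝ) ^ P.d * (2 * P.d)) * Real.sqrt (∑ b : PBond P i, ‖(pertVar (Averaging.iter (fun i => blockAvg (P := P) (j := i) (expMeanLogSU (n := Fin N))) i U₀) (Averaging.iter (fun i => blockAvg (P := P) (j := i) (expMeanLogSU (n := Fin N))) i W)) b‖ ^ 2)))))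
        + 2 * Real.sqrt P.d * ∑ j ∈ Finset.range k, Real.sqrt (4 * P.d * (((P.d : ℝ) + 2) ^ 2 * N * (P.L : ℝ) ^ 4) + (4 * ((P.d : ℝ) + 2) ^ 2 * (P.d : ℝ) ^ 3 * (3 * N + 2 * P.d) * (P.L : ℝ) ^ 6) * a' ^ 2) * (Real.exp ((159 * (((P.d + 2) * P.L : ℕ) : ℝ) * Real.sqrt (2 * P.d * (P.L : ℝ) ^ P.d * (2 * P.d))) / Real.sqrt (((P.L : ℝ) ^ P.d)⁻¹ * (P.L : ℝ) ^ 2) * ∑ i ∈ Finset.range j, a i) * (∑ i ∈ Finset.range j, Real.sqrt (((P.L : ℝ) ^ P.d)⁻¹ * (P.L : ℝ) ^ 2) ^ (j - 1 - i) * (260 * (μ i * ((((P.d + 2) * P.L : ℕ) : ℝ) * Real.sqrt (2 * P.d * (P.L : ℝ) ^ P.d * (2 * P.d)) * Real.sqrt (∑ b : PBond P i, ‖(pertVar (Averaging.iter (fun i => blockAvg (P := P) (j := i) (expMeanLogSU (n := Fin N))) i U₀) (Averaging.iter (fun i => blockAvg (P := P) (j := i) (expMeanLogSU (n := Fin N)))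 i W)) b‖ ^ 2))))))) := by
  have hQ := sqrt_sum_normSq_trueLinIter_le_of_structure U₀ hk Q hQ0 hQs (pertVar U₀ W) G S Λ hG0 hS0 hΛ0 hΛs hGs hSs a ha0 hα ha24 haN
  have hD := sqrt_sum_normSq_levelRatio_sub_trueLinIter_le_mass U₀ W hk Q hQ0 hQs a ha0 ha' hα ha24 haN hV μ hμ0 hμ hμ72 hμN
  have hM := sqrt_sum_norm_add_sq_le (fun c : PBond P k => Q k (pertVar U₀ W) c) (fun c => (pertVar (Averaging.iter (fun i => blockAvg (P := P) (j := i) (expMeanLogSU (n := Fin N))) k U₀) (Averaging.iter (fun i => blockAvg (P := P) (j := i) (expMeanLogSU (n := Fin N))) k W)) c - Q k (pertVar U₀ W) c)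
  have hE : Real.sqrt (∑ b : PBond P k, ‖(pertVar (Averaging.iter (fun i => blockAvg (P := P) (j := i) (expMeanLogSU (n := Fin N))) k U₀) (Averaging.iter (fun i => blockAvg (P := P) (j := i) (expMeanLogSU (n := Fin N))) k W)) b‖ ^ 2) = Real.sqrt (∑ c : PBond P k, ‖Q k (pertVar U₀ W) c + ((pertVar (Averaging.iter (fun i => blockAvg (P := P) (j := i) (expMeanLogSU (n := Fin N))) k U₀) (Averaging.iter (fun i => blockAvg (P := P) (j := i) (expMeanLogSU (n := Fin N))) k W)) c - Q k (pertVar U₀ W) c)‖ ^ 2) :=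
    congrArg Real.sqrt (Finset.sum_congr rfl fun c _ => by rw [add_sub_cancel])
  rw [hE]
  linarith [hM, hQ, hD]

end Summit.QuantumFields.YangMills.Theorems.Prop7FibreLevelMass

end
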